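import Summits.SmoothPoincare4.SmoothPoincare4.Theses.CongruenceShadows
import Literature.Topology.FourManifolds.StandardTrisectionSlotSymmetry
import Literature.Topology.FourManifolds.SurfaceGroupAmalgam
import Literature.Topology.FourManifolds.TrisectionFunctorGK

/-!
# `AgkCor6Sufficiency` — negative-side support: stabilisation remembers the triple; the
# re-marking automorphism in `IsStablyTrivial` is load-bearing (refuted strengthening III)

Companion of `StablyTrivialTight.lean` / `UnbalancedFalse.lean` / `AnyGroupFalse.lean` (crux item
`stmt-SmoothPoincare4-10894`, work file `Cruxes/AgkCor6Sufficiency/Disproof.lean` §13.1).  The crux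
is `X → SmoothPoincare4`, `X` = "every `(3k, k)` group trisection of the trivial group is stably
trivial", where stable triviality asks for an ISOMORPHISM (conjugation by some automorphism of
`S_{3k+3n}`) between a stabilisation of the triple and a standard triple.

* `stabRetract g : S_{g+3} ↠ S_g` — the retraction killing the three new handles (well defined
  because `r_{g+3} = ι(r_g) · σ(r_3)`); `map_stabRetract_stabilize`: `ρ (K.stabilize i) = K i` for
  normal `K i` (the stabilisation is the slot-wise free product with the `S⁴` kernels and `ρ`
  kills the second factor).  Hence `stabilize_injective`, and with the iterated retraction
  `stabRetractIter`, `map_stabRetractIter_stabilizeIter` and `eq_of_stabilizeIter_eq`: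
  **`stabilizeIter n` is injective on triples of normal subgroups** — every stabilisation
  remembers the original triple.
* `cycKernels = (N₂, N₀, N₁)` — the standard genus-`3` triple of `S⁴` with its slots cycled, i.e.
  the image of `s4Kernels` under the tree's relator-fixing cyclic handle shift `cyc`
  (`StandardTrisectionSlotSymmetry.map_cyc_s4Kernels`): a `(3, 1)` group trisection of `{1}`
  (`IsGroupTrisection.comp_perm`), isomorphic to `s4Kernels`, hence stably trivial with
  `n = m = 0`, but different from `s4Kernels` (`a₀ ∈ N₀ ∖ N₂`).
* `not_forall_isGroupTrisection_punit_stabilizeIter_eq` — **refuted strengthening III**: AGK's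
  condition with `Iso` replaced by EQUALITY ("every `(3k,k)` group trisection of `{1}` becomes
  literally a standard triple after stabilising") is false at `k = 1`, witness `cycKernels`: if
  `cycKernels.stabilizeIter n = s4Kernels.stabilizeIter n` then `ρⁿ` gives `cycKernels = s4Kernels`.
  So the change of marking inside `IsStablyTrivial` is load-bearing — `X` can be neither supplied
  nor consumed "on the nose" —, complementing `UnbalancedFalse` (`g = 3k` load-bearing) and
  `AnyGroupFalse` (`G = 1` load-bearing).  Nothing here concludes the crux or `X`.

References: A. Abrams, D. Gay, R. Kirby, *Group trisections and smooth 4-manifolds*, Geom. Topol.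
22 (2018), Def. 2–3 (connected sum, stabilisation), Cor. 6 (p. 1541); D. Gay, R. Kirby,
*Trisecting 4-manifolds*, Geom. Topol. 20 (2016), §1–2 (the genus-`3` trisection of `S⁴`).
-/

noncomputable section

-- the prescribed namespace `Summit.<P>.<Sub>.…` duplicates `SmoothPoincare4` (P = Sub)
set_option linter.dupNamespace false

namespace Summit.SmoothPoincare4.SmoothPoincare4.Theorems.AgkCor6Sufficiency.Negative

open Literature.Topology.FourManifolds Subgroup RelatorAut

variable {g : ℕ}

/-! ## The retraction `S_{g+3} ↠ S_g` and injectivity of `stabilize` -/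

/-- The surface relator dies in `S_g`. [folklore] -/
theorem mk_surfaceRelator (g : ℕ) :
    (PresentedGroup.mk ({surfaceRelator g} : Set (FreeGroup (surfaceGen g))) (surfaceRelator g) :
      SurfaceGroup g) = 1 :=
  (PresentedGroup.mk_eq_one_iff).2 (subset_normalClosure (Set.mem_singleton _))

/-- **The retraction `ρ : S_{g+3} ↠ S_g` killing the three new handles** (`aᵢ ↦ aᵢ`, `bᵢ ↦ bᵢ`
for `i < g`, `a_{g+j}, b_{g+j} ↦ 1`), well defined since `r_{g+3} = ι(r_g) · σ(r_3) ↦ 1 · 1`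
(geometrically: collapse the summand `Σ₃` of `F # Σ₃`). [folklore] -/
def stabRetract (g : ℕ) : SurfaceGroup (g + 3) →* SurfaceGroup g :=
  presentedLift
    (freeExtend (PresentedGroup.mk ({surfaceRelator g} : Set (FreeGroup (surfaceGen g))))
      (1 : FreeGroup (surfaceGen 3) →* SurfaceGroup g))
    (by
      intro r hr
      rw [Set.mem_singleton_iff] at hr
      subst hr
      rw [surfaceRelator_add_three, map_mul, genIncl_eq_genInclAdd, genShift_eq_genShiftAdd,
        ← MonoidHom.comp_apply, freeExtend_comp_genInclAdd, ← MonoidHom.comp_apply,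
        freeExtend_comp_genShiftAdd, MonoidHom.one_apply, mul_one, mk_surfaceRelator])

/-- `ρ` is the identity on the first `g` handles. [folklore] -/
@[simp] theorem stabRetract_mk_genIncl (x : FreeGroup (surfaceGen g)) :
    stabRetract g (PresentedGroup.mk _ (genIncl g x)) = PresentedGroup.mk _ x := by
  rw [stabRetract, presentedLift_mk, genIncl_eq_genInclAdd, ← MonoidHom.comp_apply,
    freeExtend_comp_genInclAdd]

/-- `ρ` kills the last three handles. [folklore] -/
@[simp] theorem stabRetract_mk_genShift (y : FreeGroup (surfaceGen 3)) :
    stabRetract g (PresentedGroup.mk _ (genShift g y)) = 1 := by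
  rw [stabRetract, presentedLift_mk, genShift_eq_genShiftAdd, ← MonoidHom.comp_apply,
    freeExtend_comp_genShiftAdd, MonoidHom.one_apply]

/-- `ρ` is surjective. [folklore] -/
theorem stabRetract_surjective : Function.Surjective (stabRetract g) := fun x => by
  obtain ⟨x, rfl⟩ := PresentedGroup.mk_surjective _ x
  exact ⟨_, stabRetract_mk_genIncl x⟩

/-- The image under `ρ` of the generating set of a stabilised kernel sits between `N` and
`N ∪ {1}`. [folklore] -/
theorem image_stabRetract_stabSet (N : Subgroup (SurfaceGroup g)) (S' : Set (SurfaceGroup 3)) :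
    stabRetract g '' stabSet (N : Set (SurfaceGroup g)) S' ⊆ (N : Set (SurfaceGroup g)) ∧
      (N : Set (SurfaceGroup g)) ⊆ stabRetract g '' stabSet (N : Set (SurfaceGroup g)) S' := by
  constructor
  · rintro _ ⟨_, (⟨x, hx, rfl⟩ | ⟨y, -, rfl⟩), rfl⟩
    · rw [Function.comp_apply, stabRetract_mk_genIncl]
      exact hx
    · rw [Function.comp_apply, stabRetract_mk_genShift]
      exact one_mem N
  · intro z hz
    obtain ⟨x, rfl⟩ := PresentedGroup.mk_surjective _ z
    exact ⟨_, Or.inl ⟨x, hz, rfl⟩, stabRetract_mk_genIncl x⟩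

/-- **Stabilisation remembers the triple: `ρ (K.stabilize i) = K i`** for normal `K i`.
[cite: AbramsGayKirby2018, Def. 2–3 (stabilisation = connected sum with the (3,1)-trisection of 1)] -/
theorem map_stabRetract_stabilize (K : TrisectionKernels g) (i : Fin 3) [(K i).Normal] :
    (K.stabilize i).map (stabRetract g) = K i := by
  rw [TrisectionKernels.stabilize_apply, map_normalClosure _ _ stabRetract_surjective]
  obtain ⟨h₁, h₂⟩ := image_stabRetract_stabSet (K i) (s4Kernels i : Set (SurfaceGroup 3))
  apply le_antisymm
  · exact normalClosure_le_normal h₁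
  · exact fun z hz => subset_normalClosure (h₂ hz)

/-- **`stabilize` is injective on triples of normal subgroups** (in particular on group
trisections of any group): `K # K_{S⁴,3} = K' # K_{S⁴,3} ⇒ K = K'`. [folklore] -/
theorem stabilize_injective {K K' : TrisectionKernels g} (hK : ∀ i, (K i).Normal)
    (hK' : ∀ i, (K' i).Normal) (h : K.stabilize = K'.stabilize) : K = K' := by
  funext i
  haveI := hK i
  haveI := hK' i
  rw [← map_stabRetract_stabilize K i, ← map_stabRetract_stabilize K' i, h]

/-- The slots of a stabilised triple are normal. [folklore] -/
instance stabilize_normal (K : TrisectionKernels g) (i : Fin 3) : (K.stabilize i).Normal := by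
  rw [TrisectionKernels.stabilize_apply]
  infer_instance

/-- The slots of an iterated stabilisation of a triple of normal subgroups are normal. [folklore] -/
theorem stabilizeIter_normal (K : TrisectionKernels g) (hK : ∀ i, (K i).Normal) :
    ∀ (n : ℕ) (i : Fin 3), (K.stabilizeIter n i).Normal
  | 0 => hK
  | n + 1 => fun i => stabilize_normal (K.stabilizeIter n) i

/-- The iterated retraction `ρⁿ : S_{g+3n} ↠ S_g`. [folklore] -/
def stabRetractIter (g : ℕ) : (n : ℕ) → (SurfaceGroup (g + 3 * n) →* SurfaceGroup g)
  | 0 => MonoidHom.id _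
  | n + 1 => (stabRetractIter g n).comp (stabRetract (g + 3 * n))

/-- **`ρⁿ (stabilizeIter K n i) = K i`**: every stabilisation remembers the original triple.
[folklore] -/
theorem map_stabRetractIter_stabilizeIter (K : TrisectionKernels g) (hK : ∀ i, (K i).Normal) :
    ∀ (n : ℕ) (i : Fin 3), (K.stabilizeIter n i).map (stabRetractIter g n) = K i
  | 0 => fun i => Subgroup.map_id _
  | n + 1 => fun i => by
    haveI := stabilizeIter_normal K hK n i
    show ((K.stabilizeIter n).stabilize i).map ((stabRetractIter g n).comp (stabRetract (g + 3 * n))) = K i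
    rw [← Subgroup.map_map, map_stabRetract_stabilize, map_stabRetractIter_stabilizeIter K hK n i]

/-- **Iterated stabilisation is injective** on triples of normal subgroups. [folklore] -/
theorem eq_of_stabilizeIter_eq {K K' : TrisectionKernels g} (hK : ∀ i, (K i).Normal)
    (hK' : ∀ i, (K' i).Normal) (n : ℕ) (h : K.stabilizeIter n = K'.stabilizeIter n) : K = K' := by
  funext i
  rw [← map_stabRetractIter_stabilizeIter K hK n i, ← map_stabRetractIter_stabilizeIter K' hK' n i, h]

/-- On group trisections (of any groups, any `k`), equal `n`-th stabilisations force equal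
triples. [folklore] -/
theorem stabilizeIter_injective_of_isGroupTrisection {k k' : ℕ} {G G' : Type} [Group G] [Group G']
    {K K' : TrisectionKernels g} (hK : IsGroupTrisection g k G K) (hK' : IsGroupTrisection g k' G' K')
    (n : ℕ) (h : K.stabilizeIter n = K'.stabilizeIter n) : K = K' :=
  eq_of_stabilizeIter_eq hK.normal hK'.normal n h

/-! ## Refuted strengthening III: stably standard ON THE NOSE is false at `k = 1` -/

/-- The standard genus-`3` triple with its slots cycled, `(N₂, N₀, N₁)`: the image of `s4Kernels`
under the relator-fixing cyclic handle shift `cyc` (`map_cyc_s4Kernels`; geometrically, the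
genus-`3` trisection of `S⁴` with its sectors relabelled). [cite: GayKirby2016, §1–2] -/
def cycKernels : TrisectionKernels 3 := fun i => s4Kernels (cycPerm i)

/-- It is a `(3,1)` group trisection of `{1}` (slot permutation invariance). [folklore] -/
theorem cycKernels_isGroupTrisection : IsGroupTrisection 3 1 (PUnit : Type) cycKernels :=
  s4Kernels_isGroupTrisection_holds.comp_perm cycPerm

/-- `s4Kernels ≅ cycKernels` by `cyc`. [folklore] -/
theorem iso_s4Kernels_cycKernels : TrisectionKernels.Iso s4Kernels cycKernels :=
  ⟨cyc.toMulEquiv, map_cyc_s4Kernels⟩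

/-- … hence `cycKernels` is stably trivial with no stabilisation at all (`n = m = 0`). [folklore] -/
theorem cycKernels_isStablyTrivial : cycKernels.IsStablyTrivial :=
  ⟨0, 0, rfl, iso_s4Kernels_cycKernels.symm⟩

/-- `a₀ ∉ N₂ = ⟪b₀, a₁, a₂⟫` (it survives in `S_3 / N₂ ≅ F⟨a₀, b₁, b₂⟩`). [folklore] -/
theorem a_zero_not_mem_s4Kernels_two : SurfaceGroup.a 0 ∉ s4Kernels 2 := by
  intro h
  have hker := s4Kernels_le_ker (s4Gens 2) (s4Gens_hits 2) 2 (fun x hx => hx) h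
  rw [MonoidHom.mem_ker, SurfaceGroup.a, eraseHom_of, eraseGen_of_not_mem (by decide)] at hker
  exact FreeGroup.of_ne_one _ hker

/-- … so the cycled triple differs from the standard one (in slot `0`: `N₂ ≠ N₀`). [folklore] -/
theorem cycKernels_ne_s4Kernels : cycKernels ≠ s4Kernels := by
  intro h
  have h0 : s4Kernels 2 = s4Kernels 0 := by
    have := congrFun h 0
    rwa [cycKernels, cycPerm_apply.1] at this
  have ha : SurfaceGroup.a 0 ∈ s4Kernels 0 := subset_normalClosure (by simp)
  rw [← h0] at ha
  exact a_zero_not_mem_s4Kernels_two ha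

/-- **Refuted strengthening III: the re-marking automorphism in `IsStablyTrivial` is
load-bearing.**  "Every `(3k,k)` group trisection of `{1}` becomes LITERALLY a standard triple
after stabilising" is false already at `k = 1`: the standard genus-`3` triple with cycled slots is
a `(3,1)` group trisection of `{1}`, isomorphic to `s4Kernels`, but no stabilisation of it EQUALS
a standard triple, since `ρⁿ : S_{3+3n} ↠ S_3` recovers the original slots from any
stabilisation. [cite: AbramsGayKirby2018, Def. 3 and Cor. 6 (p. 1541)] -/
theorem not_forall_isGroupTrisection_punit_stabilizeIter_eq :
    ¬ ∀ (k : ℕ) (K : TrisectionKernels (3 * k)), IsGroupTrisection (3 * k) k (PUnit : Type) K →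
      ∃ (n m : ℕ) (h : 3 + 3 * m = 3 * k + 3 * n),
        K.stabilizeIter n = (s4Kernels.stabilizeIter m).cast h := by
  intro h
  obtain ⟨n, m, hnm, heq⟩ := h 1 cycKernels cycKernels_isGroupTrisection
  obtain rfl : n = m := by omega
  have heq' : cycKernels.stabilizeIter n = s4Kernels.stabilizeIter n := heq
  exact cycKernels_ne_s4Kernels (eq_of_stabilizeIter_eq (fun i => cycKernels_isGroupTrisection.normal i)
    (fun i => s4Kernels_isGroupTrisection_holds.normal i) n heq')

end Summit.SmoothPoincare4.SmoothPoincare4.Theorems.AgkCor6Sufficiency.Negative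

end
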